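import Summits.ValiantsHypothesis.ValiantsHypothesis.Theorems.GrenetZeonDualUnipotentThreeHalvesHeavyTopCompositionBlocks
import Summits.ValiantsHypothesis.ValiantsHypothesis.Theorems.GrenetZeonDualUnipotentThreeHalvesHeavyTopCodimOnePlumbing
import Summits.ValiantsHypothesis.ValiantsHypothesis.Theorems.GrenetZeonDualUnipotentThreeHalvesHeavyTopCodimOneLevels
import Summits.ValiantsHypothesis.ValiantsHypothesis.Theorems.GrenetZeonDualUnipotentThreeHalvesHeavyTopCodimOnePattern
import Summits.ValiantsHypothesis.ValiantsHypothesis.Theorems.GrenetZeonDualUnipotentThreeHalvesHeavyTopCodimOneHull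
import Literature.LinearAlgebra.Matrix.GerstenhaberNilpotentSubspaceEqualityProof

/-!
# `GrenetZeon.DualUnipotentThreeHalves` (stmt-ValiantsHypothesis-24318), R2 heavy-top instrument — COROLLARY II port, step (L3):
# the CODIMENSION-ONE CLASSIFICATION IN HULL FORM (everything but the final re-indexing onto `towerHull`)

**Theorem (hull form of val-idea-30 MEMO codim-one COROLLARY II).**  Let `V ≤ M_m(ℂ)` be a nilpotent space with `dim V + 1 = C(m,2)`.  Then EITHER
some unit conjugates `V` into the strictly upper triangular matrices `𝔫_m` (so `V` is a hyperplane of a maximal nilpotent algebra), OR there are a unit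
`P`, a three-valued level function `c` on `Fin m` with re-indexings of its fibres by `Fin a₀`, `Fin 3`, `Fin a₂`, nilpotent spaces `W₀ ≤ M_{a₀}`,
`W₂ ≤ M_{a₂}` of FULL dimension `C(a₀,2)`, `C(a₂,2)` and an IRREDUCIBLE nilpotent PLANE `I ≤ M₃(ℂ)` such that
`A ∈ V ↔ P A P⁻¹` is `c`-block upper-triangular with diagonal blocks in `(W₀, I, W₂)` — i.e. `P V P⁻¹ = HULL(W₀, I, W₂)`.

Proof = the composition-chain route of crux note `CENSUS-THMC-UNIFORM-eng1g5.md` §8.5, assembling ✓ `exists_block_conj` (composition chain with irreducible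
diagonal blocks), ✓ `exists_conj_submodule` / `exists_block_image` (plumbing), ★ ✓ `levels_of_deficiency_le_one` (block sizes `{1,3}`, at most one `3`, a plane
on it), ✓ `exists_unit_strictUpper_of_injective_levels` (case α) and ✓ `hull_of_deficiency_le_one` (case β).  The remaining step to the agreed towerHull
form of COROLLARY II — Gerstenhaber-equality units on `W₀`, `W₂` (✓ `deSeguinsPazzis2013_equality_holds`, they have full dimension), the block-diagonal unit
and the re-indexing `Fin m ≃ Fin (a₂ + 3 + a₀)` (✓ `reindex_fromBlocks_mem_towerHull_iff(_left)`) — is coordinate bookkeeping for the successor.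

* ★ `codimOne_hull_form` — the theorem; ★ `codimOne_hull_form_units` — the same with the outer blocks trivialised by Gerstenhaber-equality units `Q₀`, `Q₂`.

Honest framing: a classification of extremal nilpotent subspaces (instrument row); nothing here proves or refutes `HeavyTopLaw`, 24318, S3b or 8062;
`VP ≠ VNP` is NOT proved.  No definitions.
[val-idea-30 MEMO codim-one rev 1.2 §0 COROLLARY II; cell val-heavytop-census, eng-1 g5]
-/

noncomputable section

-- single-conjunct layout: Sub = Summit, duplicated namespace component intended
set_option linter.dupNamespace false

namespace Summit.ValiantsHypothesis.ValiantsHypothesis.Theorems.GrenetZeon.HeavyTopCodimOneHullForm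

open Matrix
open Summit.ValiantsHypothesis.ValiantsHypothesis.Theorems.GrenetZeon.HeavyTopCompositionBound (exists_block_conj)
open Summit.ValiantsHypothesis.ValiantsHypothesis.Theorems.GrenetZeon.HeavyTopCodimOnePlumbing (exists_conj_submodule exists_block_image)
open Summit.ValiantsHypothesis.ValiantsHypothesis.Theorems.GrenetZeon.HeavyTopCodimOneLevels (levels_of_deficiency_le_one)
open Summit.ValiantsHypothesis.ValiantsHypothesis.Theorems.GrenetZeon.HeavyTopCodimOnePattern (injective_of_card_fiber_le_one
  exists_unit_strictUpper_of_injective_levels)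
open Summit.ValiantsHypothesis.ValiantsHypothesis.Theorems.GrenetZeon.HeavyTopCodimOneHull (hull_of_deficiency_le_one)
open Summit.ValiantsHypothesis.ValiantsHypothesis.Theorems.GrenetZeon.HeavyTopCodimOneBlocks (finrank_le_two_of_irreducible_three)
open Literature.LinearAlgebra.Matrix (IsStrictUpper)

/-- ★ **COROLLARY II in hull form.**  A nilpotent `V ≤ M_m(ℂ)` with `dim V + 1 = C(m,2)` is conjugate into `𝔫_m`, or conjugate ONTO a hull
`HULL(W₀, I, W₂)` for a three-valued level function, with `W₀`, `W₂` nilpotent of full dimension and `I ≤ M₃(ℂ)` an irreducible nilpotent plane.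
[val-idea-30 MEMO codim-one §0 COROLLARY II; composition-chain proof, this cell] -/
theorem codimOne_hull_form {m : ℕ} (V : Submodule ℂ (Matrix (Fin m) (Fin m) ℂ)) (hV : ∀ A ∈ V, IsNilpotent A)
    (hdim : Module.finrank ℂ V + 1 = m.choose 2) :
    (∃ P : Matrix (Fin m) (Fin m) ℂ, IsUnit P ∧ ∀ A ∈ V, IsStrictUpper (P * A * P⁻¹)) ∨
    (∃ (P : Matrix (Fin m) (Fin m) ℂ) (c : Fin m → ℕ) (a₀ a₂ : ℕ) (e₀ : {i : Fin m // c i = 0} ≃ Fin a₀)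
        (e₁ : {i : Fin m // c i = 1} ≃ Fin 3) (e₂ : {i : Fin m // c i = 2} ≃ Fin a₂)
        (W₀ : Submodule ℂ (Matrix (Fin a₀) (Fin a₀) ℂ)) (I : Submodule ℂ (Matrix (Fin 3) (Fin 3) ℂ))
        (W₂ : Submodule ℂ (Matrix (Fin a₂) (Fin a₂) ℂ)),
      IsUnit P ∧ (∀ i, c i ≤ 2) ∧
      (∀ X ∈ W₀, IsNilpotent X) ∧ Module.finrank ℂ W₀ = a₀.choose 2 ∧
      (∀ X ∈ W₂, IsNilpotent X) ∧ Module.finrank ℂ W₂ = a₂.choose 2 ∧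
      (∀ X ∈ I, IsNilpotent X) ∧ Module.finrank ℂ I = 2 ∧
      (∀ U : Submodule ℂ (Fin 3 → ℂ), (∀ X ∈ I, ∀ x ∈ U, X *ᵥ x ∈ U) → U = ⊥ ∨ U = ⊤) ∧
      ∀ A, A ∈ V ↔ (∀ i j, c i < c j → (P * A * P⁻¹) i j = 0) ∧
        Matrix.reindex e₀ e₀ ((P * A * P⁻¹).toBlock (fun i => c i = 0) (fun i => c i = 0)) ∈ W₀ ∧
        Matrix.reindex e₁ e₁ ((P * A * P⁻¹).toBlock (fun i => c i = 1) (fun i => c i = 1)) ∈ I ∧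
        Matrix.reindex e₂ e₂ ((P * A * P⁻¹).toBlock (fun i => c i = 2) (fun i => c i = 2)) ∈ W₂) := by
  classical
  -- Step 1: composition chain in matrix clothes
  obtain ⟨Pu, L, lvl, hlvlL, -, -, hblockP, hirrP⟩ := exists_block_conj (V : Set (Matrix (Fin m) (Fin m) ℂ))
  set P : Matrix (Fin m) (Fin m) ℂ := (Pu : Matrix (Fin m) (Fin m) ℂ) with hPdef
  have hPunit : IsUnit P := Units.isUnit Pu
  have hPinv : ((Pu⁻¹ : (Matrix (Fin m) (Fin m) ℂ)ˣ) : Matrix (Fin m) (Fin m) ℂ) = P⁻¹ := Matrix.coe_units_inv Pu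
  -- Step 2: the conjugated space
  obtain ⟨V', hV'dim, hV'mem, hV'of, hV'nil0⟩ := exists_conj_submodule V P hPunit
  have hV'nil : ∀ B ∈ V', IsNilpotent B := hV'nil0 hV
  have hV'block : ∀ B ∈ V', ∀ i j, lvl i < lvl j → B i j = 0 := by
    intro B hB i j hij
    obtain ⟨A, hA, rfl⟩ := hV'of B hB
    have := hblockP A hA i j hij
    rwa [hPinv] at this
  have hdim' : m.choose 2 ≤ Module.finrank ℂ V' + 1 := by rw [hV'dim]; omega
  -- Step 3: the diagonal-block images
  have hWex := fun t : Fin L =>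
    exists_block_image lvl V' hV'nil hV'block (t : ℕ) (Fintype.equivFin {i : Fin m // lvl i = (t : ℕ)})
  choose W hW1 hW2 hW3 hW4 using hWex
  have hWirr : ∀ t : Fin L, ∀ U : Submodule ℂ (Fin (Fintype.card {i : Fin m // lvl i = (t : ℕ)}) → ℂ),
      (∀ X ∈ W t, ∀ x ∈ U, X *ᵥ x ∈ U) → U = ⊥ ∨ U = ⊤ := by
    intro t
    refine hW4 t fun U hU => hirrP t t.isLt _ (Fintype.equivFin _) U fun A hA x hx => ?_
    rw [hPinv] at *
    exact hU _ ((hV'mem A).1 hA) x hx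
  -- Step 4: the deficiency count
  obtain ⟨hsize, huniq, hplane⟩ := levels_of_deficiency_le_one lvl hlvlL (fun t => Fintype.card {i : Fin m // lvl i = (t : ℕ)})
    (fun t => Fintype.equivFin _) V' hV'block W (fun A hA t => hW1 t A hA) hW3 hWirr hdim'
  -- Step 5: cases
  by_cases h3 : ∃ t : Fin L, Fintype.card {i : Fin m // lvl i = (t : ℕ)} = 3
  · -- (β) one 3-block at level t₀: coarsen to three levels
    right
    obtain ⟨t₀, ht₀⟩ := h3
    let c : Fin m → ℕ := fun i => if lvl i < (t₀ : ℕ) then 0 else if lvl i = (t₀ : ℕ) then 1 else 2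
    have hc : ∀ i, c i ≤ 2 := fun i => by dsimp only [c]; split_ifs <;> omega
    have hc1 : ∀ i, c i = 1 ↔ lvl i = (t₀ : ℕ) := fun i => by
      dsimp only [c]; split_ifs with h1 h2
      · exact ⟨fun h => absurd h (by decide), fun h => absurd h (by omega)⟩
      · exact ⟨fun _ => h2, fun _ => rfl⟩
      · exact ⟨fun h => absurd h (by decide), fun h => absurd h h2⟩
    have hcblock : ∀ B ∈ V', ∀ i j, c i < c j → B i j = 0 := by
      intro B hB i j hij
      apply hV'block B hB i j
      dsimp only [c] at hij; split_ifs at hij <;> omega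
    -- re-indexings of the three fibres
    let e₁ : {i : Fin m // c i = 1} ≃ Fin 3 :=
      (Equiv.subtypeEquivRight hc1).trans ((Fintype.equivFin {i : Fin m // lvl i = (t₀ : ℕ)}).trans (finCongr ht₀))
    let e₀ : {i : Fin m // c i = 0} ≃ Fin (Fintype.card {i : Fin m // c i = 0}) := Fintype.equivFin _
    let e₂ : {i : Fin m // c i = 2} ≃ Fin (Fintype.card {i : Fin m // c i = 2}) := Fintype.equivFin _
    obtain ⟨W₀, hW₀1, -, hW₀3, -⟩ := exists_block_image c V' hV'nil hcblock 0 e₀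
    obtain ⟨W₂, hW₂1, -, hW₂3, -⟩ := exists_block_image c V' hV'nil hcblock 2 e₂
    obtain ⟨I, hI1, -, hI3, hI4⟩ := exists_block_image c V' hV'nil hcblock 1 e₁
    -- the middle block is the irreducible block `t₀` of the chain, re-indexed by `e₁`
    let e' : {i : Fin m // lvl i = (t₀ : ℕ)} ≃ Fin 3 := (Equiv.subtypeEquivRight hc1).symm.trans e₁
    have hblk : ∀ B : Matrix (Fin m) (Fin m) ℂ,
        Matrix.reindex e' e' (B.toBlock (fun i => lvl i = (t₀ : ℕ)) (fun i => lvl i = (t₀ : ℕ))) =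
          Matrix.reindex e₁ e₁ (B.toBlock (fun i => c i = 1) (fun i => c i = 1)) := by
      intro B
      ext a b
      rfl
    have hIirr : ∀ U : Submodule ℂ (Fin 3 → ℂ), (∀ X ∈ I, ∀ x ∈ U, X *ᵥ x ∈ U) → U = ⊥ ∨ U = ⊤ := by
      refine hI4 fun U hU => hirrP t₀ t₀.isLt 3 e' U fun A hA x hx => ?_
      rw [hPinv, hblk] at *
      exact hU _ ((hV'mem A).1 hA) x hx
    have hIle : Module.finrank ℂ I ≤ 2 := finrank_le_two_of_irreducible_three I hI3 hIirr
    obtain ⟨hf₀, hf₂, hfI, -, hmem⟩ :=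
      hull_of_deficiency_le_one c hc e₀ e₁ e₂ V' hcblock W₀ I W₂ hW₀1 hI1 hW₂1 hW₀3 hIle hW₂3 hdim'
    refine ⟨P, c, _, _, e₀, e₁, e₂, W₀, I, W₂, hPunit, hc, hW₀3, hf₀, hW₂3, hf₂, hI3, hfI, hIirr, fun A => ?_⟩
    rw [hV'mem A]
    exact hmem _
  · -- (α) all levels of size ≤ 1: triangularisable
    left
    have hsize' : ∀ t : Fin L, Fintype.card {i : Fin m // lvl i = (t : ℕ)} ≤ 1 := by
      intro t
      rcases hsize t with h | h
      · exact h
      · exact absurd ⟨t, h⟩ h3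
    have hinj := injective_of_card_fiber_le_one lvl hlvlL hsize'
    obtain ⟨Q, hQ, hQV⟩ := exists_unit_strictUpper_of_injective_levels lvl hlvlL hinj V' hV'nil hV'block
    refine ⟨Q * P, hQ.mul hPunit, fun A hA => ?_⟩
    have h := hQV _ ((hV'mem A).1 hA)
    rw [show Q * P * A * (Q * P)⁻¹ = Q * (P * A * P⁻¹) * Q⁻¹ by rw [Matrix.mul_inv_rev]; simp only [Matrix.mul_assoc]]
    exact h

/-- ★ **COROLLARY II in hull form, outer blocks trivialised.**  As `codimOne_hull_form`, with the two outer block spaces replaced by units `Q₀`, `Q₂`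
conjugating them onto the strictly upper triangular matrices (Gerstenhaber's equality case ✓ `deSeguinsPazzis2013_equality_holds`, applicable since
they have full dimension): `A ∈ V ↔ P A P⁻¹` is `c`-block upper-triangular, its outer diagonal blocks become strictly upper under `Q₀`, `Q₂`, and its
middle block lies in the irreducible nilpotent plane `I`.  (Successor: block-diagonal unit + re-indexing onto ✓ `towerHull`.) -/
theorem codimOne_hull_form_units {m : ℕ} (V : Submodule ℂ (Matrix (Fin m) (Fin m) ℂ)) (hV : ∀ A ∈ V, IsNilpotent A)
    (hdim : Module.finrank ℂ V + 1 = m.choose 2) :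
    (∃ P : Matrix (Fin m) (Fin m) ℂ, IsUnit P ∧ ∀ A ∈ V, IsStrictUpper (P * A * P⁻¹)) ∨
    (∃ (P : Matrix (Fin m) (Fin m) ℂ) (c : Fin m → ℕ) (a₀ a₂ : ℕ) (e₀ : {i : Fin m // c i = 0} ≃ Fin a₀)
        (e₁ : {i : Fin m // c i = 1} ≃ Fin 3) (e₂ : {i : Fin m // c i = 2} ≃ Fin a₂)
        (Q₀ : Matrix (Fin a₀) (Fin a₀) ℂ) (I : Submodule ℂ (Matrix (Fin 3) (Fin 3) ℂ)) (Q₂ : Matrix (Fin a₂) (Fin a₂) ℂ),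
      IsUnit P ∧ (∀ i, c i ≤ 2) ∧ IsUnit Q₀ ∧ IsUnit Q₂ ∧
      (∀ X ∈ I, IsNilpotent X) ∧ Module.finrank ℂ I = 2 ∧
      (∀ U : Submodule ℂ (Fin 3 → ℂ), (∀ X ∈ I, ∀ x ∈ U, X *ᵥ x ∈ U) → U = ⊥ ∨ U = ⊤) ∧
      ∀ A, A ∈ V ↔ (∀ i j, c i < c j → (P * A * P⁻¹) i j = 0) ∧
        IsStrictUpper (Q₀ * Matrix.reindex e₀ e₀ ((P * A * P⁻¹).toBlock (fun i => c i = 0) (fun i => c i = 0)) * Q₀⁻¹) ∧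
        Matrix.reindex e₁ e₁ ((P * A * P⁻¹).toBlock (fun i => c i = 1) (fun i => c i = 1)) ∈ I ∧
        IsStrictUpper (Q₂ * Matrix.reindex e₂ e₂ ((P * A * P⁻¹).toBlock (fun i => c i = 2) (fun i => c i = 2)) * Q₂⁻¹)) := by
  rcases codimOne_hull_form V hV hdim with h | ⟨P, c, a₀, a₂, e₀, e₁, e₂, W₀, I, W₂, hP, hc, hW₀n, hW₀d, hW₂n, hW₂d, hIn, hId, hIirr, hmem⟩
  · exact Or.inl h
  · right
    obtain ⟨Q₀, hQ₀, hQ₀W⟩ := Literature.LinearAlgebra.Matrix.GerstenhaberNilpotentSubspace.deSeguinsPazzis2013_equality_holds ℂ a₀ W₀ hW₀n hW₀d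
    obtain ⟨Q₂, hQ₂, hQ₂W⟩ := Literature.LinearAlgebra.Matrix.GerstenhaberNilpotentSubspace.deSeguinsPazzis2013_equality_holds ℂ a₂ W₂ hW₂n hW₂d
    refine ⟨P, c, a₀, a₂, e₀, e₁, e₂, Q₀, I, Q₂, hP, hc, hQ₀, hQ₂, hIn, hId, hIirr, fun A => ?_⟩
    rw [hmem A, hQ₀W, hQ₂W]


end Summit.ValiantsHypothesis.ValiantsHypothesis.Theorems.GrenetZeon.HeavyTopCodimOneHullForm

end
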